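import Literature.MathematicalPhysics.QuantumFieldTheory.Balaban1983to89.B1Eq31Concrete

/-!
# `Balaban1983to89.HiggsActionIntegrable` — T. Bałaban, *(Higgs)₂,₃ quantum fields in a finite volume. I. A lower bound*,
Commun. Math. Phys. **85** (1982) 603–626 [Balaban1982Higgs1], (1.10)–(1.11) p. 605: the partition function
`Z^ε = ∫dA∫dφ exp(−S^ε(A, φ))` of the (Higgs)₂,₃ lattice model IS A CONVERGENT INTEGRAL and is positive under the
paper's standing assumptions *"μ₀² > 0 and λ > 0"* — carrier facts over `…HiggsLattice` (`action` (1.11), `partitionFn`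
(1.10)) needed by every lower-bound step ((3.6) p. 613 and onwards), PROVED

statement-level skeleton of published theorems with citation tags; proofs where landed; nothing here is a claim about the Yang–Mills mass gap

PDF held: `paper:balaban1982-cmp85-higgs23-i` (journal page = PDF page + 602).  (1.10)–(1.11) read from the ×2 render
`run/shared/lean/pub/pub-balaban/b2b-balaban-ref1/pages/1982-cmp85-higgs23-I/…-p003-x2.png` (p. 605), never from the OCR.

CITATION HEADER (lean-in-tree rule).  lit-balaban typed skeleton (HOME `run/shared/lean/pub/lit-balaban/`), typer line
(carrier API; rows of record unchanged): rows **B1.Eq1.9-1.10 / B1.Eq1.11** (owner r14; carriers `HiggsLattice.partitionFn`,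
`HiggsLattice.action`, typed).  WHAT IS REPRODUCED.  p. 605 [PDF 3], verbatim: *"Z^ε = ∫dA∫dφ exp(−S^ε(A, φ)) (1.10) …
S^ε(A, φ) = ½⟨φ, (−Δ^ε_A)φ⟩ + Σ_x ε^d(½m₀²|φ(x)|² + λ|φ(x)|⁴) + ½⟨A, (δ^εd^ε + μ₀²)A⟩ + E (1.11) … We assume μ₀² > 0
and λ > 0."*  `∫dA∫dφ` = product Lebesgue measure over bonds and sites (p. 605).
PROVED, in this order: (§1) joint continuity in `(A, φ)` of the covariant derivative (1.7) and of the action (1.11)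
(`continuous_covDeriv`, `continuous_action`; hence `exp(−S^ε)` is measurable); (§2) a Gaussian minorant of the action for
`λ > 0` and ANY real `m₀² = m² + δm²` (`action_ge`: `S^ε ≥ E − |T^{(k)}|ε^d(1 − m₀²/2)²/(4λ) + ½μ₀²Σ_b ε^d A_b² +
Σ_x ε^d|φ(x)|²`, completing the square sitewise, `quartic_lower`), whence **`exp(−S^ε) ∈ L¹(dA dφ)` for `μ₀² > 0`,
`λ > 0`** (`integrable_exp_neg_action`) and **`Z^ε > 0`** (`partitionFn_pos`).  Stated at every level `k` of the tower
(the carriers are level-generic; p. 605 is `k = 0`).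
DELIBERATELY NOT HERE: anything about the renormalization transformations.
Unit `lit-balaban-typer` gen 3 (literature-prover-lit-balaban-typer-g3-0); HOME/FILED.md records the proposal.
-/

open scoped BigOperators
open _root_.MeasureTheory _root_.Real

namespace Literature.MathematicalPhysics.QuantumFieldTheory.Balaban1983to89.HiggsActionIntegrable

open Literature.MathematicalPhysics.QuantumFieldTheory.Balaban1983to89.HiggsLattice
open Literature.MathematicalPhysics.QuantumFieldTheory.Balaban1983to89.B1Eq31Concrete (continuous_chargeU)

variable {P : Params} {k N : ℕ}

/-! ## 1. Joint continuity in `(A, φ)` of the covariant derivative (1.7) and of the action (1.11) -/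

section Continuity

/-- `(A, φ) ↦ (D^η_A φ)(b)` (1.7) is jointly continuous. [cite: Balaban1982Higgs1, (1.7) p.605] -/
theorem continuous_covDeriv (C : ChargeData N) (b : PBond P k) :
    Continuous fun p : VecField P k × ScalarField P k N => covDeriv C p.1 p.2 b := by
  have hU : Continuous fun p : VecField P k × ScalarField P k N => C.U (P.mesh k) (p.1 b) :=
    (continuous_chargeU C (P.mesh k)).comp ((continuous_apply b).comp continuous_fst)
  have hφ : ∀ x : Site P k, Continuous fun p : VecField P k × ScalarField P k N => p.2 x :=
    fun x => (continuous_apply x).comp continuous_snd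
  have h1 : Continuous fun p : VecField P k × ScalarField P k N => C.U (P.mesh k) (p.1 b) (p.2 b.tgt) :=
    hU.clm_apply (hφ b.tgt)
  unfold covDeriv
  exact (h1.sub (hφ b.src)).const_smul ((P.mesh k)⁻¹)

/-- **The action (1.11) is jointly continuous in `(A, φ)`** (hence `exp(−S^ε)` is measurable). [cite: Balaban1982Higgs1, (1.11) p.605] -/
theorem continuous_action (C : ChargeData N) (c : Couplings) :
    Continuous fun p : VecField P k × ScalarField P k N => action C c p.1 p.2 := by
  have hA : ∀ b : PBond P k, Continuous fun p : VecField P k × ScalarField P k N => p.1 b :=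
    fun b => (continuous_apply b).comp continuous_fst
  have hφ : ∀ x : Site P k, Continuous fun p : VecField P k × ScalarField P k N => ‖p.2 x‖ :=
    fun x => ((continuous_apply x).comp continuous_snd).norm
  have h1 : Continuous fun p : VecField P k × ScalarField P k N => covLaplaceForm C p.1 p.2 := by
    have ht : ∀ b : PBond P k, Continuous fun p : VecField P k × ScalarField P k N =>
        P.mesh k ^ P.d * ‖covDeriv C p.1 p.2 b‖ ^ 2 :=
      fun b => (((continuous_covDeriv C b).norm).pow 2).const_mul (P.mesh k ^ P.d)
    unfold covLaplaceForm
    exact continuous_finsetSum _ fun b _ => ht b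
  have h2 : Continuous fun p : VecField P k × ScalarField P k N => potential c p.2 := by
    have ht : ∀ x : Site P k, Continuous fun p : VecField P k × ScalarField P k N =>
        P.mesh k ^ P.d * (c.m0sq / 2 * ‖p.2 x‖ ^ 2 + c.lam * ‖p.2 x‖ ^ 4) :=
      fun x => ((((hφ x).pow 2).const_mul (c.m0sq / 2)).add (((hφ x).pow 4).const_mul c.lam)).const_mul
        (P.mesh k ^ P.d)
    unfold potential
    exact continuous_finsetSum _ fun x _ => ht x
  have h3 : Continuous fun p : VecField P k × ScalarField P k N => vecLaplaceForm p.1 := by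
    have ht : ∀ (μ : Fin P.d) (b : PBond P k), Continuous fun p : VecField P k × ScalarField P k N =>
        P.mesh k ^ P.d * ((P.mesh k)⁻¹ • (p.1 ⟨b.tgt, μ⟩ - p.1 ⟨b.src, μ⟩)) ^ 2 :=
      fun μ b => ((((hA ⟨b.tgt, μ⟩).sub (hA ⟨b.src, μ⟩)).const_smul ((P.mesh k)⁻¹)).pow 2).const_mul
        (P.mesh k ^ P.d)
    have hμ : ∀ μ : Fin P.d, Continuous fun p : VecField P k × ScalarField P k N =>
        ∑ b : PBond P k, P.mesh k ^ P.d * ((P.mesh k)⁻¹ • (p.1 ⟨b.tgt, μ⟩ - p.1 ⟨b.src, μ⟩)) ^ 2 :=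
      fun μ => continuous_finsetSum _ fun b _ => ht μ b
    have hs := continuous_finsetSum (Finset.univ : Finset (Fin P.d)) fun μ _ => hμ μ
    exact hs
  have h4 : Continuous fun p : VecField P k × ScalarField P k N =>
      ∑ b : PBond P k, P.mesh k ^ P.d * (c.mu0sq * (p.1 b) ^ 2) := by
    have ht : ∀ b : PBond P k, Continuous fun p : VecField P k × ScalarField P k N =>
        P.mesh k ^ P.d * (c.mu0sq * (p.1 b) ^ 2) :=
      fun b => (((hA b).pow 2).const_mul c.mu0sq).const_mul (P.mesh k ^ P.d)
    exact continuous_finsetSum _ fun b _ => ht b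
  have h := (((h1.div_const 2).add h2).add ((h3.add h4).div_const 2)).add
    (continuous_const : Continuous fun _ : VecField P k × ScalarField P k N => c.E)
  exact h

/-- `exp(−S^ε)` is (jointly) measurable. [cite: Balaban1982Higgs1, (1.10) p.605] -/
theorem measurable_exp_neg_action (C : ChargeData N) (c : Couplings) :
    Measurable fun p : VecField P k × ScalarField P k N => Real.exp (-action C c p.1 p.2) :=
  (Real.continuous_exp.comp (continuous_action C c).neg).measurable

end Continuity

/-! ## 2. `exp(−S^ε)` is integrable and `0 < Z^ε` under the standing assumptions `μ₀² > 0`, `λ > 0` -/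

section Integrability

/-- One-site bound behind the integrability of `exp(−ε^d(½m₀²|φ|² + λ|φ|⁴))` for `λ > 0` and ANY real `m₀²`:
`½m₀²r² + λr⁴ ≥ r² − (1 − m₀²/2)²/(4λ)` (complete the square). [cite: Balaban1982Higgs1, (1.11) p.605] -/
theorem quartic_lower (m lam : ℝ) (hlam : 0 < lam) (r : ℝ) :
    r ^ 2 - (1 - m / 2) ^ 2 / (4 * lam) ≤ m / 2 * r ^ 2 + lam * r ^ 4 := by
  have h : m / 2 * r ^ 2 + lam * r ^ 4 - (r ^ 2 - (1 - m / 2) ^ 2 / (4 * lam))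
      = (2 * lam * r ^ 2 - (1 - m / 2)) ^ 2 / (4 * lam) := by
    field_simp
    ring
  have h' : 0 ≤ (2 * lam * r ^ 2 - (1 - m / 2)) ^ 2 / (4 * lam) := by positivity
  linarith

/-- The constant `K = ε^d (1 − m₀²/2)²/(4λ)` lost per site in `quartic_lower`. [cite: Balaban1982Higgs1, (1.11) p.605] -/
noncomputable def siteLoss (P : Params) (k : ℕ) (c : Couplings) : ℝ :=
  P.mesh k ^ P.d * ((1 - c.m0sq / 2) ^ 2 / (4 * c.lam))

/-- **A Gaussian minorant of the action (1.11)** for `λ > 0`: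
`S^ε(A, φ) ≥ E − |T^{(k)}|·K + ½ Σ_b ε^d μ₀² A_b² + Σ_x ε^d |φ(x)|²` (drop the two non-negative kinetic forms, bound the
self-interaction sitewise by `quartic_lower`). [cite: Balaban1982Higgs1, (1.11) p.605] -/
theorem action_ge (C : ChargeData N) (c : Couplings) (hlam : 0 < c.lam) (A : VecField P k) (φ : ScalarField P k N) :
    c.E - Fintype.card (Site P k) * siteLoss P k c
        + (∑ b : PBond P k, P.mesh k ^ P.d * (c.mu0sq * (A b) ^ 2)) / 2
        + ∑ x : Site P k, P.mesh k ^ P.d * ‖φ x‖ ^ 2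
      ≤ action C c A φ := by
  have hcov : 0 ≤ covLaplaceForm C A φ :=
    Finset.sum_nonneg fun b _ => mul_nonneg (pow_nonneg (P.mesh_pos k).le _) (sq_nonneg _)
  have hvec : 0 ≤ vecLaplaceForm A :=
    Finset.sum_nonneg fun μ _ => Finset.sum_nonneg fun b _ => mul_nonneg (pow_nonneg (P.mesh_pos k).le _) (sq_nonneg _)
  have hpot : ∑ x : Site P k, P.mesh k ^ P.d * ‖φ x‖ ^ 2 - Fintype.card (Site P k) * siteLoss P k c
      ≤ potential c φ := by
    have hsite : ∀ x : Site P k, P.mesh k ^ P.d * ‖φ x‖ ^ 2 - siteLoss P k c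
        ≤ P.mesh k ^ P.d * (c.m0sq / 2 * ‖φ x‖ ^ 2 + c.lam * ‖φ x‖ ^ 4) := by
      intro x
      have h := mul_le_mul_of_nonneg_left (quartic_lower c.m0sq c.lam hlam ‖φ x‖) (pow_nonneg (P.mesh_pos k).le P.d)
      unfold siteLoss
      rw [mul_sub] at h
      exact h
    have hsum := Finset.sum_le_sum fun x (_ : x ∈ (Finset.univ : Finset (Site P k))) => hsite x
    rw [Finset.sum_sub_distrib, Finset.sum_const, Finset.card_univ, nsmul_eq_mul] at hsum
    exact hsum
  unfold action
  linarith

/-- The Gaussian `exp(−b|v|²)`, `b > 0`, is integrable on `ℝ^N` (its integral is `(π/b)^{N/2} ≠ 0`). [folklore] -/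
private theorem integrable_exp_neg_mul_sq_norm {b : ℝ} (hb : 0 < b) :
    Integrable fun v : EuclideanSpace ℝ (Fin N) => Real.exp (-b * ‖v‖ ^ 2) := by
  refine Integrable.of_integral_ne_zero ?_
  rw [GaussianFourier.integral_rexp_neg_mul_sq_norm hb]
  exact (Real.rpow_pos_of_pos (div_pos Real.pi_pos hb) _).ne'

/-- The Gaussian majorant of `exp(−S^ε)` given by `action_ge` is integrable for the product Lebesgue measure
`dA dφ` when `μ₀² > 0` (a product of one-dimensional Gaussians in the `A_b` and `N`-dimensional Gaussians in the
`φ(x)`). [cite: Balaban1982Higgs1, (1.10) p.605] -/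
theorem integrable_majorant (c : Couplings) (hmu : 0 < c.mu0sq) :
    Integrable fun Φ : VecField P k × ScalarField P k N =>
      Real.exp (Fintype.card (Site P k) * siteLoss P k c - c.E)
        * ((∏ b : PBond P k, Real.exp (-(P.mesh k ^ P.d * c.mu0sq / 2) * (Φ.1 b) ^ 2))
          * ∏ x : Site P k, Real.exp (-(P.mesh k ^ P.d) * ‖Φ.2 x‖ ^ 2)) := by
  have hA : Integrable fun A : VecField P k => ∏ b : PBond P k, Real.exp (-(P.mesh k ^ P.d * c.mu0sq / 2) * (A b) ^ 2) :=
    Integrable.fintype_prod (f := fun (_ : PBond P k) (t : ℝ) => Real.exp (-(P.mesh k ^ P.d * c.mu0sq / 2) * t ^ 2))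
      fun _ => integrable_exp_neg_mul_sq (by have := P.mesh_pos k; positivity)
  have hφ : Integrable fun φ : ScalarField P k N => ∏ x : Site P k, Real.exp (-(P.mesh k ^ P.d) * ‖φ x‖ ^ 2) :=
    Integrable.fintype_prod (f := fun (_ : Site P k) (v : EuclideanSpace ℝ (Fin N)) =>
      Real.exp (-(P.mesh k ^ P.d) * ‖v‖ ^ 2)) fun _ => integrable_exp_neg_mul_sq_norm (pow_pos (P.mesh_pos k) _)
  have h := (hA.mul_prod hφ).const_mul (Real.exp (Fintype.card (Site P k) * siteLoss P k c - c.E))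
  rw [← Measure.volume_eq_prod] at h
  exact h

/-- **`exp(−S^ε(A, φ))` is integrable for `dA dφ`** (p. 605: the partition function (1.10) is a convergent integral)
under the standing assumptions `μ₀² > 0`, `λ > 0` of p. 605 (any real `m₀² = m² + δm²`, any `e`, any `E`). PROVED
(continuity + the Gaussian majorant). [cite: Balaban1982Higgs1, (1.10) p.605] -/
theorem integrable_exp_neg_action (C : ChargeData N) (c : Couplings) (hmu : 0 < c.mu0sq) (hlam : 0 < c.lam) :
    Integrable fun Φ : VecField P k × ScalarField P k N => Real.exp (-action C c Φ.1 Φ.2) := by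
  refine (integrable_majorant (P := P) (k := k) (N := N) c hmu).mono'
    (measurable_exp_neg_action C c).aestronglyMeasurable (Filter.Eventually.of_forall fun Φ => ?_)
  rw [Real.norm_eq_abs, abs_of_pos (Real.exp_pos _), ← Real.exp_sum, ← Real.exp_sum, ← Real.exp_add,
    ← Real.exp_add, Real.exp_le_exp]
  have h := action_ge C c hlam Φ.1 Φ.2
  have e1 : ∑ b : PBond P k, -(P.mesh k ^ P.d * c.mu0sq / 2) * (Φ.1 b) ^ 2
      = -((∑ b : PBond P k, P.mesh k ^ P.d * (c.mu0sq * (Φ.1 b) ^ 2)) / 2) := by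
    rw [Finset.sum_div, ← Finset.sum_neg_distrib]
    refine Finset.sum_congr rfl fun b _ => ?_
    ring
  have e2 : ∑ x : Site P k, -(P.mesh k ^ P.d) * ‖Φ.2 x‖ ^ 2 = -∑ x : Site P k, P.mesh k ^ P.d * ‖Φ.2 x‖ ^ 2 := by
    rw [← Finset.sum_neg_distrib]
    refine Finset.sum_congr rfl fun x _ => ?_
    ring
  rw [e1, e2]
  linarith

/-- **`Z^ε > 0`** ((1.10) is the integral of a positive integrable function against a non-zero measure).
[cite: Balaban1982Higgs1, (1.10) p.605] -/
theorem partitionFn_pos (C : ChargeData N) (c : Couplings) (hmu : 0 < c.mu0sq) (hlam : 0 < c.lam) :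
    0 < partitionFn P k N C c := by
  haveI : (volume : Measure (VecField P k × ScalarField P k N)).IsAddHaarMeasure :=
    Measure.prod.instIsAddHaarMeasure (volume : Measure (VecField P k)) (volume : Measure (ScalarField P k N))
  unfold partitionFn
  exact integral_exp_pos (integrable_exp_neg_action C c hmu hlam)

/-- `Z^ε` is the integral of `exp(−S^ε)` over the product space (the form in which the lower-bound steps use it).
[cite: Balaban1982Higgs1, (1.10) p.605] -/
theorem partitionFn_eq (C : ChargeData N) (c : Couplings) :
    partitionFn P k N C c = ∫ Φ : VecField P k × ScalarField P k N, Real.exp (-action C c Φ.1 Φ.2) := rfl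

end Integrability

end Literature.MathematicalPhysics.QuantumFieldTheory.Balaban1983to89.HiggsActionIntegrable
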